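import Mathlib
import Literature.MathematicalPhysics.QuantumFieldTheory.Balaban1983to89.B6Prop27Kernel
import Literature.MathematicalPhysics.QuantumFieldTheory.Balaban1983to89.B6Prop23TwoLevel

/-!
# `Balaban1983to89.B6Prop27TwoLevel` — Proposition 2.7 (2.149) ∕ Proposition 2.3 (2.87) at a general scaling power p
WITHOUT the single-level hypothesis: the (2.82)–(2.87) chain of `…B6Prop27Kernel` for cubes whose supports meet the
TWO adjacent levels j_□, j_□ + 1 (B6 = T. Bałaban, *Propagators and renormalization transformations for lattice gauge
theories. II*, Commun. Math. Phys. **96**, 223–250 (1984) [Balaban1984PropagatorsII]).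

CITATION HEADER (lean-in-tree rule 2026-08-18).  Cell `pub-balaban`, unit `b2b-balaban-b06-g16` (paper sub-cell B06,
gen 16 — the owner lineage of `…B6Prop27Kernel` (the power-p chain with `hlev`, p187387) and `…B6Prop23TwoLevel` (the
two-level chain at p = 4, p185663), both imported BY NAME and not modified).  Source: doi:10.1007/bf01240221, held
`paper:balaban1984-cmp96-propagators-rt-ii`; journal page = PDF page + 222; renders read AS IMAGES for this module:
`b2b-balaban-ref1/pages/1984-cmp96-propagators-rt-II/1984-cmp96-propagators-rt-II-p013-x2.png` (p. 235), `…-p015-x2.png`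
(p. 237), `…-p026-x2.png` (p. 248), `…-p027-x2.png` (p. 249), all four this gen.  Cell rows GAPS C-b06g16-2, DIVERGENCE
D-b06.36; journal claim PROP27-TWO-LEVEL.

THE PRINTED TEXT.  p. 249 [PDF 27]: *"We form the equality for QGQ*C in exactly the same way as in (2.82) replacing only
in the definition of R_{□,□′} the operators Q′, G′(□̃)², G′² by Q, G_□, G. We have the same estimates now as before, but
with powers of scaling factors changed properly (we replace +4 and −4 in (2.83) by +2 and −2), thus we have (2.85) and
this implies Proposition 2.7. The operator (QGQ*)⁻¹ is given by the convergent expansions of the form (2.86), and it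
satisfies the bound |(QGQ*)⁻¹(b, b′)| ≤ O(1)(L^jη)^{−2}(L^{j′}η)^{−d}e^{−½δ₄d(b,b′)}, b ∈ Λ_j, b′ ∈ Λ_{j′}. (2.149)"*;
p. 248 [PDF 26]: *"Keeping the same notations as before we consider the operators C_□ = ((QG_□Q*)↾_□)⁻¹,
C = Σ_{□∈𝒟} h_□C_□h_□. (2.143)"* — the cubes □ ∈ 𝒟 are those of pp. 229–235, of which p. 235 [PDF 13] says *"we take a
second cube □̃ containing □ in the middle and of the size 4M … At first let us find bounds on C_□. We assume that either
□̃ ⊂ B^j(Λ_j), or it intersects B^{j+1}(Λ_{j+1}) also."*; p. 237 [PDF 15], after (2.83): *"where we have used the fact that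
y ∉ □′, and all the properties of the distance d(·, ·)."*

WHY THIS MODULE.  `…B6Prop27Kernel.inverse_assembled_pow` (and its p = 2 edge `prop27Printed_of_assembled` to the census
declaration `B6.Prop27Printed`) carries — like its p = 4 model `…B6Prop23Assembled.prop23_assembled` — the located
restriction `hlev` "supp h_□ lies on ONE level", which the printed cover does not have (a boundary cube meets two levels).
For p = 4 the restriction was removed in `…B6Prop23TwoLevel` at the price L⁴ ↦ L⁸ in the off-diagonal constant κ₄.  Here
the same is done ONCE FOR ALL p: the nearest support point y₀ of h_{□′} and the column y′ ∈ supp h_{□′} both lie in □′,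
so j(y₀) ≤ j(y′) + 1 by the cube scale fact, and the scale weight of (2.83) at power p obeys the LEVEL SLACK
L^{p(j−j′)} ≤ L^p·L^{p(j−j(y₀))} (`ratioP_le_Lp_mul`); the rest of the chain is `…B6Prop27Kernel`'s, with κ₄ ↦ L^p·κ₄
(`kappa4TLP`), θ ↦ θᵀᴸ (`theta285TLP`), K ↦ Kᵀᴸ (`K285TLP`).  At p = 4 the new constants ARE those of `…B6Prop23TwoLevel`
(`kappa4TLP_four`, `theta285TLP_four`, `K285TLP_four`), so gen-14's `prop23_assembled_twoLevel` is the p = 4 reading and is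
not re-filed; at p = 2 the edge `prop27Printed_of_assembled_twoLevel` gives Proposition 2.7 for the printed two-level cover.

WHAT THIS MODULE PROVES (kernel-checked; no `sorry`; every analytic input a hypothesis with free constants):
1. §1 `ratioP_le_Lp_mul` (level slack at power p), `line3P_le_line5P_twoLevel`, `line2P_le_line5P_twoLevel` (member 2 of
   (2.83) ≤ c·L^p·member 5 for a support point at most one level above y′);
2. §2 `line4Ker_abs_le_285_pow_twoLevel` (member 1 in the (2.85) shape, constant A_X A_C c L^pL^p e^{−⅛δ₀Mg});
3. §3 `offPiece_abs_le_pow_twoLevel` (the family □ ≠ □′ without `hlev`), the constants `kappa4TLP` = L^p·κ₄ (`kappa4TLP_eq`),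
   `theta285TLP`, `K285TLP` with `theta285TLP_le` (θᵀᴸ ≤ Kᵀᴸ∕M) and `K285P_le_K285TLP` (the two-level threshold implies the
   single-level one), `mat_off_abs_le_pow_twoLevel`, (2.85) `mat_R_abs_le_pow_twoLevel`, and **`inverse_assembled_pow_twoLevel`**:
   the statement of `inverse_assembled_pow` WITHOUT `hlev` (threshold M ≥ 2Kᵀᴸc; conclusion verbatim: unique two-sided
   inverse G = C + GR, |G(y,y′)| ≤ 2n₀B_C L^{d+p}c·(L^jη)^{−p}(L^{j′}η)^{−d}e^{−½δ₁d(y,y′)});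
4. §4 the p = 2 edge **`prop27Printed_of_assembled_twoLevel : … → B6.Prop27Printed d geo Qinv`** = `prop27Printed_of_assembled`
   without `hlev` (threshold `K285TLP … 2`);
5. §5 the p = 4 DICTIONARY `kappa4TLP_four`, `theta285TLP_four`, `K285TLP_four` (= `…B6Prop23TwoLevel`'s constants);
6. §6 NON-VACUITY ON A TWO-LEVEL MODEL: on gen-14's two-site model `B6Prop23TwoLevel.tlGeo` (one cube meeting the levels 0
   and 1, where `hlev` FAILS, `B6Prop23TwoLevel.tlGeo_hlev_fails`) every hypothesis of the p = 2 edge is discharged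
   (`prop27Printed_twoLevel_tl`), constants `tlGeo_K285TLP`, `tlGeo_thresholdP_tl`.

HONEST SCOPE.  Exactly the inputs of `…B6Prop27Kernel` minus `hlev`: (2.142)∕(2.68)-type majorants of X, X̃_□ with the
factor (L^jη)^p, the change-of-domain majorant with e^{−c₃M}, the cube-inverse bound B_C(L^{j_□}η)^{−d−p}e^{−δ₁d} on □ × □
((2.148) in the d-metric form ∕ (2.81)), Lipschitz h_□, the cover facts (□ ∈ {0,1}, □h_□ = h_□, (2.36), n₀, cube scales
{j_□, j_□+1}, gap m_g·M, C_□ = 0 off □), the (2.143)∕(2.70)-identity, (2.54), (2.60) `LevelSep`, (2.61)∕(2.63) with generic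
constants, L^p ≤ e^{⅛δ₀RM}, M ≥ 2Kᵀᴸc — hypotheses with free constants, none cited as a fact (cell ABSOLUTE RULE); the
uniformity of the constants over the family is ASSUMED in the edge, as in the siblings.  Value = a fidelity certificate
(the printed generality of the cover for Prop. 2.7, and for every p at once); NOT summit progress.
-/

namespace Literature.MathematicalPhysics.QuantumFieldTheory.Balaban1983to89.B6Prop27TwoLevel

open Literature.MathematicalPhysics.QuantumFieldTheory.Balaban1983to89
open Finset B6RandomWalk B6Lemma21Repaired B6Expansion282 B6Ineq268 B6Ineq283 B6Prop23Chain B6Line4Member12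
  B6Prop23Assembled B6Prop23Printed B6Prop27Kernel B6Prop23TwoLevel

/-! ## §1. The level slack at power p and the two-level chain (2.83), members 2 ⇒ 5 -/

section TwoLevelChain

variable {g : B6.Geometry}

/-- THE LEVEL SLACK at power p: if j(y₀) ≤ j(y′) + 1 then L^{p(j−j′)} ≤ L^p·L^{p(j−j(y₀))} (L ≥ 1)
(p = 4: `B6Prop23TwoLevel.ratio4_le_L4_mul`). [folklore] -/
theorem ratioP_le_Lp_mul (hL : 1 ≤ g.L) (p : ℕ) {y y' y₀ : g.Site} (hadj : g.scale y₀ ≤ g.scale y' + 1) :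
    ratioP g p y y' ≤ g.L ^ p * ratioP g p y y₀ := by
  have hL0 : 0 < g.L := zero_lt_one.trans_le hL
  have h1 : g.L ^ (p * g.scale y₀) ≤ g.L ^ p * g.L ^ (p * g.scale y') := by
    rw [← pow_add]
    have h := Nat.mul_le_mul_left p hadj
    rw [Nat.mul_add, Nat.mul_one] at h
    exact pow_le_pow_right₀ hL (by omega)
  have hq : 1 ≤ g.L ^ p * g.L ^ (p * g.scale y') / g.L ^ (p * g.scale y₀) := by
    rw [one_le_div (pow_pos hL0 _)]
    exact h1
  unfold ratioP
  rw [div_le_iff₀ (pow_pos hL0 _)]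
  calc g.L ^ (p * g.scale y) = g.L ^ (p * g.scale y) * 1 := (mul_one _).symm
    _ ≤ g.L ^ (p * g.scale y) * (g.L ^ p * g.L ^ (p * g.scale y') / g.L ^ (p * g.scale y₀)) :=
        mul_le_mul_of_nonneg_left hq (pow_nonneg hL0.le _)
    _ = g.L ^ p * (g.L ^ (p * g.scale y) / g.L ^ (p * g.scale y₀)) * g.L ^ (p * g.scale y') := by ring

/-- **(2.83) MEMBER 3 ≤ L^p · MEMBER 5 FOR A TWO-LEVEL SUPPORT, at power p.**  If D ≥ d(y, y₀) for a support point y₀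
with j(y₀) ≤ j(y′) + 1, the gap Mg ≤ D («y ∉ □′»), (2.60) in metric form, L ≥ 1 and L^p ≤ e^{⅛δ₀RM}, then
L^{p(j−j′)}e^{−¼δ₀D}e^{−δ₁d(y,y′)} ≤ L^p·(L^pe^{−⅛δ₀Mg}e^{−δ₁d(y,y′)}): ¼δ₀D ≥ ⅛δ₀Mg + ⅛δ₀RM·max{|j−j(y₀)|−1,0}, the
absorption `B6Prop27Kernel.ratioP_mul_exp_le` and the slack `ratioP_le_Lp_mul` (p = 4: `line3_le_line5_twoLevel`).
[cite: Balaban1984PropagatorsII, (2.83) p.237 + p.235 + «replace +4 and −4 … by +2 and −2» p.249] -/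
theorem line3P_le_line5P_twoLevel (p : ℕ) (hsep : LevelSep g) (hL : 1 ≤ g.L) {δ₀ δ₁ D Mg : ℝ} (hδ₀ : 0 ≤ δ₀)
    (hRM : 0 ≤ g.R * g.M) (hthr : g.L ^ p ≤ Real.exp (1 / 8 * δ₀ * g.R * g.M)) {y y' y₀ : g.Site}
    (hadj : g.scale y₀ ≤ g.scale y' + 1) (hy₀ : g.dist y y₀ ≤ D) (hgap : Mg ≤ D) :
    line283P_3 g p δ₀ δ₁ D y y' ≤ g.L ^ p * line283P_5 g p δ₀ δ₁ Mg y y' := by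
  have hL0 : 0 < g.L := zero_lt_one.trans_le hL
  have hβ : 0 ≤ 1 / 8 * δ₀ * g.R * g.M := by
    have : 0 ≤ δ₀ * (g.R * g.M) := mul_nonneg hδ₀ hRM
    linarith
  have hlev : g.R * g.M * mx g y y₀ ≤ D := (hsep y y₀).trans hy₀
  have hkey : Real.exp (-(1 / 4 * δ₀ * D)) ≤
      Real.exp (-(1 / 8 * δ₀ * Mg)) * Real.exp (-(1 / 8 * δ₀ * g.R * g.M * mx g y y₀)) := by
    rw [← Real.exp_add, Real.exp_le_exp]
    have h1 : δ₀ * Mg ≤ δ₀ * D := mul_le_mul_of_nonneg_left hgap hδ₀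
    have h2 : δ₀ * (g.R * g.M * mx g y y₀) ≤ δ₀ * D := mul_le_mul_of_nonneg_left hlev hδ₀
    linarith
  have habs : ratioP g p y y₀ * Real.exp (-(1 / 8 * δ₀ * g.R * g.M * mx g y y₀)) ≤ g.L ^ p :=
    ratioP_mul_exp_le hL hβ p hthr y y₀
  have hA : ratioP g p y y' ≤ g.L ^ p * ratioP g p y y₀ := ratioP_le_Lp_mul hL p hadj
  have hr₀ : 0 ≤ ratioP g p y y₀ := ratioP_nonneg hL0.le p y y₀
  have hr : 0 ≤ ratioP g p y y' := ratioP_nonneg hL0.le p y y'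
  unfold line283P_3 line283P_5
  calc ratioP g p y y' * Real.exp (-(1 / 4 * δ₀ * D)) * Real.exp (-(δ₁ * g.dist y y'))
      ≤ (g.L ^ p * ratioP g p y y₀) *
          (Real.exp (-(1 / 8 * δ₀ * Mg)) * Real.exp (-(1 / 8 * δ₀ * g.R * g.M * mx g y y₀))) *
          Real.exp (-(δ₁ * g.dist y y')) :=
        mul_le_mul_of_nonneg_right (mul_le_mul hA hkey (Real.exp_pos _).le (by positivity)) (Real.exp_pos _).le
    _ = g.L ^ p * (ratioP g p y y₀ * Real.exp (-(1 / 8 * δ₀ * g.R * g.M * mx g y y₀))) *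
          Real.exp (-(1 / 8 * δ₀ * Mg)) * Real.exp (-(δ₁ * g.dist y y')) := by ring
    _ ≤ g.L ^ p * g.L ^ p * Real.exp (-(1 / 8 * δ₀ * Mg)) * Real.exp (-(δ₁ * g.dist y y')) := by
        have hp0 : 0 ≤ g.L ^ p := pow_nonneg hL0.le p
        gcongr
    _ = g.L ^ p * (g.L ^ p * Real.exp (-(1 / 8 * δ₀ * Mg)) * Real.exp (-(δ₁ * g.dist y y'))) := by ring

/-- **THE WHOLE TWO-LEVEL CHAIN AT POWER p, MEMBER 2 ≤ c·L^p·MEMBER 5**, under (2.54), d ≥ 0, (2.60) in metric form,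
(2.61) at α = σ with δ₁ + σδ₀ ≤ ¼δ₀ and generic constant c, the straight-contour comparison on supp h_{□′}, D realised by a
support point y₀ AT MOST ONE LEVEL above y′, the gap Mg ≤ D and L^p ≤ e^{⅛δ₀RM} (`B6Prop27Kernel.line2P_le_line3P` +
`line3P_le_line5P_twoLevel`; p = 4: `line2_le_line5_twoLevel`). [cite: Balaban1984PropagatorsII, (2.83) p.237 + p.235 + p.249] -/
theorem line2P_le_line5P_twoLevel (p : ℕ) (htri : Triangle254 g) (hd : ∀ a b : g.Site, 0 ≤ g.dist a b)
    (hsep : LevelSep g) (hL : 1 ≤ g.L) {δ₀ δ₁ σ c D Mg : ℝ} (hδ₀ : 0 ≤ δ₀) (hδ₁ : 0 ≤ δ₁)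
    (hsplit : δ₁ + σ * δ₀ ≤ δ₀ / 4) (h261 : Ineq261With c g δ₀ σ) (hRM : 0 ≤ g.R * g.M)
    (hthr : g.L ^ p ≤ Real.exp (1 / 8 * δ₀ * g.R * g.M)) {S' : Finset g.Site} {ρ : g.Site → ℝ}
    {y y' y₀ : g.Site} (hρ : ∀ y'' ∈ S', g.dist y'' y' ≤ ρ y'') (hD : ∀ y'' ∈ S', D ≤ g.dist y y'')
    (hadj : g.scale y₀ ≤ g.scale y' + 1) (hy₀ : g.dist y y₀ ≤ D) (hgap : Mg ≤ D) :
    line283P_2 g p δ₀ δ₁ S' ρ y y' ≤ c * (g.L ^ p * line283P_5 g p δ₀ δ₁ Mg y y') := by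
  have hL0 : 0 < g.L := zero_lt_one.trans_le hL
  have hc : 0 ≤ c := c_nonneg_of_ineq261With h261 y
  refine (line2P_le_line3P p htri hd hL0 hδ₀ hδ₁ hsplit h261 hρ hD).trans (mul_le_mul_of_nonneg_left ?_ hc)
  exact line3P_le_line5P_twoLevel p hsep hL hδ₀ hRM hthr hadj hy₀ hgap

end TwoLevelChain

/-! ## §2. Member 1 of (2.83) at power p in the (2.85) shape, two-level support -/

section Member1

variable {g : B6.Geometry}

/-- **THE (2.85) READING OF THE OFF-DIAGONAL FAMILY AT POWER p, TWO-LEVEL SUPPORT**: with the inputs of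
`B6Prop27Kernel.line4Ker_abs_le_285_pow` except that the support point y₀ realising D = d(y, supp h_{□′}) is only required
to satisfy j(y₀) ≤ j(y′) + 1 (instead of j(y₀) = j(y′)):
|line4Ker(y, y′)| ≤ (A_X A_C c L^pL^p e^{−⅛δ₀Mg})·e^{−δ₁d(y,y′)}·P(y′) (p = 4: `line4Ker_abs_le_285_twoLevel`).
[cite: Balaban1984PropagatorsII, (2.83)–(2.85) pp.237–238 + p.235 + p.249] -/
theorem line4Ker_abs_le_285_pow_twoLevel (p : ℕ) (htri : Triangle254 g) (hd : ∀ a b : g.Site, 0 ≤ g.dist a b)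
    (hsep : LevelSep g) (hL : 1 ≤ g.L) (hη : 0 < g.eta)
    {δ₀ δ₁ σ c D Mg AX AC : ℝ} (hδ₀ : 0 ≤ δ₀) (hδ₁ : 0 ≤ δ₁) (hsplit : δ₁ + σ * δ₀ ≤ δ₀ / 4)
    (h261 : Ineq261With c g δ₀ σ) (hRM : 0 ≤ g.R * g.M)
    (hthr : g.L ^ p ≤ Real.exp (1 / 8 * δ₀ * g.R * g.M)) (hAX : 0 ≤ AX) (hAC : 0 ≤ AC)
    {P : g.Site → ℝ} (hP : ∀ z, 0 ≤ P z)
    {w p' h h' : g.Site → ℝ} {X C : g.Site → g.Site → ℝ} {S' : Finset g.Site} {ρ : g.Site → ℝ}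
    {y y' y₀ : g.Site}
    (hX : ∀ y'', |w y'' * X y y''| ≤ AX * g.len y ^ p * Real.exp (-(1 / 2 * δ₀ * g.dist y y'')))
    (hC : ∀ y'' ∈ S', |C y'' y'| ≤ AC * P y' / g.len y' ^ p * Real.exp (-(δ₁ * ρ y'')))
    (hC0 : ∀ y'', y'' ∉ S' → C y'' y' = 0)
    (hρ : ∀ y'' ∈ S', g.dist y'' y' ≤ ρ y'') (hD : ∀ y'' ∈ S', D ≤ g.dist y y'')
    (hadj : g.scale y₀ ≤ g.scale y' + 1) (hy₀ : g.dist y y₀ ≤ D) (hgap : Mg ≤ D)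
    (hp1 : |p' y - 1| ≤ 1) (hh1 : |h y| ≤ 1) (hh'1 : ∀ y'', |h' y''| ≤ 1) :
    |line4Ker w p' h h' X C y y'| ≤
      (AX * AC * c * (g.L ^ p * g.L ^ p) * Real.exp (-(1 / 8 * δ₀ * Mg))) * Real.exp (-(δ₁ * g.dist y y')) *
        P y' := by
  have h1 := line4Ker_abs_le_pow p hL hη hX hC hC0 hp1 hh1 hh'1
  have h25 := line2P_le_line5P_twoLevel p htri hd hsep hL hδ₀ hδ₁ hsplit h261 hRM hthr hρ hD hadj hy₀ hgap
    (δ₁ := δ₁)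
  calc |line4Ker w p' h h' X C y y'| ≤ AX * (AC * P y') * line283P_2 g p δ₀ δ₁ S' ρ y y' := h1
    _ ≤ AX * (AC * P y') * (c * (g.L ^ p * line283P_5 g p δ₀ δ₁ Mg y y')) :=
        mul_le_mul_of_nonneg_left h25 (mul_nonneg hAX (mul_nonneg hAC (hP y')))
    _ = _ := by unfold line283P_5; ring

end Member1

/-! ## §3. The off-diagonal family, (2.85) and the assembled inverse at power p without `hlev` -/

section Pieces

variable {g : B6.Geometry} {D : Type}

/-- **LINE 4 (THE FAMILY □ ≠ □′, (2.83)) AT POWER p, weighted entry, TWO-LEVEL SUPPORTS.**  For all cubes □, □′ and all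
y, y′: |(L^{j′}η)^d · ((□′ − 1)h_□²Xh_{□′}C_{□′}h_{□′})(y, y′)| ≤ (B_X (B_C L^{d+p}) c_σ L^pL^p e^{−⅛δ₀·m_g M})·e^{−δ₁d(y,y′)} —
the statement of `B6Prop27Kernel.offPiece_abs_le_pow` WITHOUT its hypothesis `hlev` (and with L^p ↦ L^pL^p): the nearest
support point y₀ of h_{□′} and the column y′ ∈ supp h_{□′} both lie in □′ (□′h_{□′} = h_{□′}), hence j(y₀) ≤ j(y′) + 1 by
the cube scale fact (`B6Prop23Assembled.scale_le_of_cube`), and `line4Ker_abs_le_285_pow_twoLevel` applies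
(p = 4: `offPiece_abs_le_twoLevel`). [cite: Balaban1984PropagatorsII, (2.83) p.237 + p.235 + p.249] -/
theorem offPiece_abs_le_pow_twoLevel (d p : ℕ) (htri : Triangle254 g) (hd : ∀ a b : g.Site, 0 ≤ g.dist a b)
    (hsep : LevelSep g) (hL : 1 ≤ g.L) (hη : 0 < g.eta) {δ₀ δ₁ σ cσ mg BX BC : ℝ} (hδ₀ : 0 < δ₀)
    (hδ₁ : 0 ≤ δ₁) (hsplit : δ₁ + σ * δ₀ ≤ δ₀ / 4) (h261σ : Ineq261With cσ g δ₀ σ) (hRM : 0 ≤ g.R * g.M)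
    (hthr : g.L ^ p ≤ Real.exp (1 / 8 * δ₀ * g.R * g.M)) (hBX : 0 ≤ BX) (hBC : 0 ≤ BC)
    {pf hf : D → g.Site → ℝ} {js : D → ℕ} {X : g.Site → g.Site → ℝ} {Ck : D → g.Site → g.Site → ℝ}
    (hpf01 : ∀ i y, pf i y = 0 ∨ pf i y = 1) (hph : ∀ i y, pf i y * hf i y = hf i y)
    (hh1 : ∀ i y, |hf i y| ≤ 1) (hcube : ∀ i y, pf i y ≠ 0 → js i ≤ g.scale y ∧ g.scale y ≤ js i + 1)
    (hgap : ∀ i y y'', pf i y = 0 → hf i y'' ≠ 0 → mg * g.M ≤ g.dist y y'')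
    (hX : ∀ y y'', |g.len y'' ^ d * X y y''| ≤ BX * g.len y ^ p * Real.exp (-(1 / 2 * δ₀ * g.dist y y'')))
    (h2148 : ∀ i y y', pf i y ≠ 0 → pf i y' ≠ 0 →
      |Ck i y y'| ≤ BC / (g.L ^ js i * g.eta) ^ (d + p) * Real.exp (-(δ₁ * g.dist y y')))
    (i i' : D) (y y' : g.Site) :
    |g.len y' ^ d * line4Ker (fun z => g.len z ^ d) (pf i') (hf i) (hf i') X (Ck i') y y'| ≤
      (BX * (BC * g.L ^ (d + p)) * cσ * (g.L ^ p * g.L ^ p) * Real.exp (-(1 / 8 * δ₀ * (mg * g.M)))) *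
        Real.exp (-(δ₁ * g.dist y y')) := by
  classical
  have hL0 : 0 < g.L := zero_lt_one.trans_le hL
  have hlen : ∀ z : g.Site, 0 < g.len z := fun z => mul_pos (pow_pos hL0 _) hη
  have hly : 0 < g.len y := hlen y
  have hly' : 0 < g.len y' := hlen y'
  have hc0 : 0 ≤ cσ := c_nonneg_of_ineq261With h261σ y
  have hRHS : 0 ≤ (BX * (BC * g.L ^ (d + p)) * cσ * (g.L ^ p * g.L ^ p) * Real.exp (-(1 / 8 * δ₀ * (mg * g.M)))) *
      Real.exp (-(δ₁ * g.dist y y')) := by positivity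
  set w : g.Site → ℝ := fun z => g.len z ^ d with hw
  by_cases hy' : hf i' y' = 0
  · have : line4Ker w (pf i') (hf i) (hf i') X (Ck i') y y' = 0 := by unfold line4Ker; rw [hy', mul_zero]
    rw [this, mul_zero, abs_zero]; exact hRHS
  by_cases hy : pf i' y = 0
  swap
  · -- y ∈ □′: the factor (□′(y) − 1) vanishes
    have h1 : pf i' y = 1 := (hpf01 i' y).resolve_left hy
    have : line4Ker w (pf i') (hf i) (hf i') X (Ck i') y y' = 0 := by
      unfold line4Ker; rw [h1, sub_self, zero_mul, zero_mul, zero_mul]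
    rw [this, mul_zero, abs_zero]; exact hRHS
  -- y ∉ □′, y′ ∈ supp h_{□′} ⊂ □′
  have hpy' : pf i' y' ≠ 0 := pf_ne_zero_of_hf_ne_zero hph hy'
  set C' : g.Site → g.Site → ℝ := fun y'' z => if hf i' y'' = 0 then 0 else Ck i' y'' z with hC'
  set S' : Finset g.Site := Finset.univ.filter fun y'' => hf i' y'' ≠ 0 with hS'
  have hne : S'.Nonempty := ⟨y', Finset.mem_filter.mpr ⟨Finset.mem_univ _, hy'⟩⟩
  obtain ⟨y₀, hy₀S, hy₀min⟩ := Finset.exists_min_image S' (fun y'' => g.dist y y'') hne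
  have hy₀ : hf i' y₀ ≠ 0 := (Finset.mem_filter.mp hy₀S).2
  -- the two-level slack: y₀ and y′ lie in □′, whose sites have scale j_{□′} or j_{□′} + 1
  have hadj : g.scale y₀ ≤ g.scale y' + 1 := scale_le_of_cube hcube (pf_ne_zero_of_hf_ne_zero hph hy₀) hpy'
  set Dm : ℝ := g.dist y y₀ with hDm
  have hCb : ∀ y'' ∈ S', |C' y'' y'| ≤ BC * g.L ^ (d + p) * (g.len y' ^ d)⁻¹ / g.len y' ^ p *
      Real.exp (-(δ₁ * g.dist y'' y')) := by
    intro y'' hy''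
    have h'' : hf i' y'' ≠ 0 := (Finset.mem_filter.mp hy'').2
    rw [hC']; simp only [if_neg h'']
    exact ck_weighted_le_pow d p hL hη hBC hcube h2148 (pf_ne_zero_of_hf_ne_zero hph h'') hpy'
  have hC0 : ∀ y'', y'' ∉ S' → C' y'' y' = 0 := by
    intro y'' hy''
    have : ¬ hf i' y'' ≠ 0 := fun h => hy'' (Finset.mem_filter.mpr ⟨Finset.mem_univ _, h⟩)
    rw [hC']; simp only [not_not.mp this, if_true]
  have hmain := line4Ker_abs_le_285_pow_twoLevel p htri hd hsep hL hη hδ₀.le hδ₁ hsplit h261σ hRM hthr hBX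
    (by positivity : 0 ≤ BC * g.L ^ (d + p)) (P := fun z => (g.len z ^ d)⁻¹)
    (fun z => inv_nonneg.mpr (pow_nonneg (hlen z).le d)) (w := w) (p' := pf i') (h := hf i) (h' := hf i')
    (X := X) (C := C') (S' := S') (ρ := fun y'' => g.dist y'' y') (y := y) (y' := y') (y₀ := y₀) (D := Dm)
    (Mg := mg * g.M) (hX y) hCb hC0 (fun y'' _ => le_rfl) (fun y'' hy'' => hy₀min y'' hy'')
    hadj le_rfl (hgap i' y y₀ hy hy₀) (abs_pf_sub_one_le_one hpf01 i' y) (hh1 i y) (hh1 i')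
  have hwP : g.len y' ^ d * (g.len y' ^ d)⁻¹ = 1 := mul_inv_cancel₀ (pow_pos (hlen y') d).ne'
  rw [line4Ker_mask, abs_mul, abs_of_pos (pow_pos (hlen y') d)]
  calc g.len y' ^ d * |line4Ker w (pf i') (hf i) (hf i') X C' y y'|
      ≤ g.len y' ^ d * ((BX * (BC * g.L ^ (d + p)) * cσ * (g.L ^ p * g.L ^ p) *
          Real.exp (-(1 / 8 * δ₀ * (mg * g.M)))) * Real.exp (-(δ₁ * g.dist y y')) * (g.len y' ^ d)⁻¹) :=
        mul_le_mul_of_nonneg_left hmain (pow_nonneg (hlen y').le d)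
    _ = (BX * (BC * g.L ^ (d + p)) * cσ * (g.L ^ p * g.L ^ p) * Real.exp (-(1 / 8 * δ₀ * (mg * g.M)))) *
          Real.exp (-(δ₁ * g.dist y y')) * (g.len y' ^ d * (g.len y' ^ d)⁻¹) := by ring
    _ = _ := by rw [hwP, mul_one]

/-- κ₄ᵀᴸ at power p: the size of the off-diagonal family in front of e^{−⅛δ₀m_gM} for two-level supports — L^p times the
single-level κ₄ of `B6Prop27Kernel.kappa4P` (`offPiece_abs_le_pow_twoLevel`; p = 4: `B6Prop23TwoLevel.kappa4TL`).
[cite: Balaban1984PropagatorsII, (2.83)/(2.85) pp.237–238 + p.249] -/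
noncomputable def kappa4TLP (g : B6.Geometry) (d p : ℕ) (cσ BX BC : ℝ) : ℝ :=
  g.L ^ p * kappa4P g d p cσ BX BC

/-- Bookkeeping: κ₄ᵀᴸ = B_X(B_C L^{d+p})c_σ·L^pL^p, the constant produced by `offPiece_abs_le_pow_twoLevel`. [folklore] -/
theorem kappa4TLP_eq (g : B6.Geometry) (d p : ℕ) (cσ BX BC : ℝ) :
    kappa4TLP g d p cσ BX BC = BX * (BC * g.L ^ (d + p)) * cσ * (g.L ^ p * g.L ^ p) := by
  unfold kappa4TLP kappa4P
  ring

/-- θᵀᴸ of (2.85) at power p for two-level supports: θᵀᴸ = n₀(κ₂/M + κ₃e^{−c₃M}) + n₀²κ₄ᵀᴸe^{−(⅛δ₀m_g)M} (the diagonal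
sizes κ₂, κ₃ of `…B6Prop27Kernel` unchanged; p = 4: `B6Prop23TwoLevel.theta285TL`). [cite: Balaban1984PropagatorsII, (2.85) p.238 + p.249] -/
noncomputable def theta285TLP (g : B6.Geometry) (d p n₀ : ℕ) (s δ₀ cσ c₃ mg BX BD BC : ℝ) : ℝ :=
  n₀ * (kappa2P g d p s δ₀ cσ BX BC / g.M + kappa3P g d p cσ BD BC * Real.exp (-(c₃ * g.M))) +
    n₀ ^ 2 * (kappa4TLP g d p cσ BX BC * Real.exp (-((1 / 8 * δ₀ * mg) * g.M)))

/-- Kᵀᴸ at power p with θᵀᴸ ≤ Kᵀᴸ/M: Kᵀᴸ = n₀(κ₂ + κ₃/(e c₃)) + n₀²κ₄ᵀᴸ/(e·⅛δ₀m_g) (p = 4: `B6Prop23TwoLevel.K285TL`).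
[cite: Balaban1984PropagatorsII, (2.85) p.238 + p.249] -/
noncomputable def K285TLP (g : B6.Geometry) (d p n₀ : ℕ) (s δ₀ cσ c₃ mg BX BD BC : ℝ) : ℝ :=
  n₀ * (kappa2P g d p s δ₀ cσ BX BC + kappa3P g d p cσ BD BC / (Real.exp 1 * c₃)) +
    n₀ ^ 2 * (kappa4TLP g d p cσ BX BC / (Real.exp 1 * (1 / 8 * δ₀ * mg)))

/-- **θᵀᴸ = O(M⁻¹) at power p**: θᵀᴸ ≤ Kᵀᴸ/M (`B6Prop23Chain.theta_le_inv_M`).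
[cite: Balaban1984PropagatorsII, (2.85) «O(M⁻¹)» p.238 + p.249] -/
theorem theta285TLP_le (hM : 0 < g.M) {d p n₀ : ℕ} {s δ₀ cσ c₃ mg BX BD BC : ℝ} (hδ₀ : 0 < δ₀) (hc₃ : 0 < c₃)
    (hmg : 0 < mg) (hcσ : 0 ≤ cσ) (hBX : 0 ≤ BX) (hBD : 0 ≤ BD) (hBC : 0 ≤ BC) (hL : 0 ≤ g.L) :
    theta285TLP g d p n₀ s δ₀ cσ c₃ mg BX BD BC ≤ K285TLP g d p n₀ s δ₀ cσ c₃ mg BX BD BC / g.M := by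
  unfold theta285TLP K285TLP
  exact theta_le_inv_M hM hc₃ (by positivity : 0 < 1 / 8 * δ₀ * mg) (by unfold kappa3P; positivity)
    (by unfold kappa4TLP kappa4P; positivity) (Nat.cast_nonneg n₀)

/-- The two-level constant dominates the single-level one at every power: K ≤ Kᵀᴸ (L ≥ 1, non-negative sizes), so the
threshold M ≥ 2Kᵀᴸc implies the single-level threshold M ≥ 2Kc of `B6Prop27Kernel.inverse_assembled_pow`
(p = 4: `B6Prop23TwoLevel.K285_le_K285TL`). [folklore] -/
theorem K285P_le_K285TLP (hL : 1 ≤ g.L) {d p n₀ : ℕ} {s δ₀ cσ c₃ mg BX BD BC : ℝ} (hδ₀ : 0 < δ₀) (hmg : 0 < mg)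
    (hcσ : 0 ≤ cσ) (hBX : 0 ≤ BX) (hBC : 0 ≤ BC) :
    K285P g d p n₀ s δ₀ cσ c₃ mg BX BD BC ≤ K285TLP g d p n₀ s δ₀ cσ c₃ mg BX BD BC := by
  have hL0 : 0 ≤ g.L := zero_le_one.trans hL
  have hκ0 : 0 ≤ kappa4P g d p cσ BX BC := by unfold kappa4P; positivity
  have hκ : kappa4P g d p cσ BX BC ≤ kappa4TLP g d p cσ BX BC := by
    unfold kappa4TLP
    exact le_mul_of_one_le_left hκ0 (one_le_pow₀ hL)
  have he : 0 < Real.exp 1 * (1 / 8 * δ₀ * mg) := by positivity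
  unfold K285P K285TLP
  gcongr

variable [DecidableEq g.Site] [Fintype D] [DecidableEq D]

omit [Fintype D] in
/-- **THE OFF-DIAGONAL TERMS R_{□,□′}C_{□′}h_{□′}, □ ≠ □′, AT POWER p, TWO-LEVEL SUPPORTS** —
`B6Prop27Kernel.mat_off_abs_le_pow` without `hlev`: |mat(R_{□,□′}C_{□′}h_{□′}) y y′| ≤ κ₄ᵀᴸe^{−(⅛δ₀m_g)M}·e^{−δ₁d(y,y′)}
(p = 4: `mat_off_abs_le_twoLevel`). [cite: Balaban1984PropagatorsII, (2.83)/(2.85) pp.237–238 + p.235 + p.249] -/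
theorem mat_off_abs_le_pow_twoLevel (d p : ℕ) (htri : Triangle254 g) (hd : ∀ a b : g.Site, 0 ≤ g.dist a b)
    (hsep : LevelSep g) (hL : 1 ≤ g.L) (hη : 0 < g.eta) {δ₀ δ₁ σ cσ mg BX BC : ℝ} (hδ₀ : 0 < δ₀)
    (hδ₁ : 0 ≤ δ₁) (hsplit : δ₁ + σ * δ₀ ≤ δ₀ / 4) (h261σ : Ineq261With cσ g δ₀ σ) (hRM : 0 ≤ g.R * g.M)
    (hthr : g.L ^ p ≤ Real.exp (1 / 8 * δ₀ * g.R * g.M)) (hBX : 0 ≤ BX) (hBC : 0 ≤ BC)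
    {pf hf : D → g.Site → ℝ} {js : D → ℕ} {X : g.Site → g.Site → ℝ} {Xw Ck : D → g.Site → g.Site → ℝ}
    (hpf01 : ∀ i y, pf i y = 0 ∨ pf i y = 1) (hph : ∀ i y, pf i y * hf i y = hf i y)
    (hh1 : ∀ i y, |hf i y| ≤ 1) (hcube : ∀ i y, pf i y ≠ 0 → js i ≤ g.scale y ∧ g.scale y ≤ js i + 1)
    (hgap : ∀ i y y'', pf i y = 0 → hf i y'' ≠ 0 → mg * g.M ≤ g.dist y y'')
    (hX : ∀ y y'', |g.len y'' ^ d * X y y''| ≤ BX * g.len y ^ p * Real.exp (-(1 / 2 * δ₀ * g.dist y y'')))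
    (h2148 : ∀ i y y', pf i y ≠ 0 → pf i y' ≠ 0 →
      |Ck i y y'| ≤ BC / (g.L ^ js i * g.eta) ^ (d + p) * Real.exp (-(δ₁ * g.dist y y')))
    {i i' : D} (hii : i ≠ i') (y y' : g.Site) :
    |mat (Rpair (kerOp (fun z => g.len z ^ d) X) (fun i => mulOp (pf i))
        (fun i => kerOp (fun z => g.len z ^ d) (Xw i)) (fun i => mulOp (hf i)) i i' *
        kerOp (fun z => g.len z ^ d) (Ck i') * mulOp (hf i')) y y'| ≤
      kappa4TLP g d p cσ BX BC * Real.exp (-((1 / 8 * δ₀ * mg) * g.M)) * Real.exp (-(δ₁ * g.dist y y')) := by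
  set w : g.Site → ℝ := fun z => g.len z ^ d with hw
  have hop : Rpair (kerOp w X) (fun i => mulOp (pf i)) (fun i => kerOp w (Xw i)) (fun i => mulOp (hf i)) i i' *
        kerOp w (Ck i') * mulOp (hf i') = kerOp w (line4Ker w (pf i') (hf i) (hf i') X (Ck i')) := by
    rw [Rpair_ne _ _ _ _ hii, line4_operator_eq]
  rw [hop, mat_kerOp]
  have h4 := offPiece_abs_le_pow_twoLevel d p htri hd hsep hL hη hδ₀ hδ₁ hsplit h261σ hRM hthr hBX hBC hpf01 hph hh1
    hcube hgap hX h2148 i i' y y'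
  refine h4.trans (le_of_eq ?_)
  simp only [kappa4TLP, kappa4P]
  ring_nf

/-- **(2.85) AT POWER p WITH NO PER-TERM HYPOTHESIS AND NO SINGLE-LEVEL HYPOTHESIS LEFT**: |mat R y y′| ≤ θᵀᴸ·e^{−δ₁d(y,y′)}
(`B6Prop27Kernel.mat_diag_abs_le_pow` for the diagonal families, `mat_off_abs_le_pow_twoLevel` for □ ≠ □′, the counting
assembly `B6Prop23Chain.mat_R282_abs_le` with the overlap number n₀; p = 4: `mat_R_abs_le_twoLevel`).
[cite: Balaban1984PropagatorsII, (2.85) p.238 + «thus we have (2.85)» p.249] -/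
theorem mat_R_abs_le_pow_twoLevel (d p : ℕ) (htri : Triangle254 g) (hd : ∀ a b : g.Site, 0 ≤ g.dist a b)
    (hsep : LevelSep g) (hL : 1 ≤ g.L) (hη : 0 < g.eta) (hM : 0 < g.M) (hRM : 0 ≤ g.R * g.M)
    {δ₀ δ₁ σ cσ c₃ s mg BX BD BC : ℝ} (hδ₀ : 0 < δ₀) (hδ₁ : 0 ≤ δ₁) (hsplit : δ₁ + σ * δ₀ ≤ δ₀ / 4)
    (h261σ : Ineq261With cσ g δ₀ σ) (hthr : g.L ^ p ≤ Real.exp (1 / 8 * δ₀ * g.R * g.M)) (hs : 0 ≤ s)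
    (hBX : 0 ≤ BX) (hBD : 0 ≤ BD) (hBC : 0 ≤ BC)
    {pf hf : D → g.Site → ℝ} {js : D → ℕ} {n₀ : ℕ} {X : g.Site → g.Site → ℝ}
    {Xw Ck : D → g.Site → g.Site → ℝ}
    (hover : ∀ y, (Finset.univ.filter fun i => hf i y ≠ 0).card ≤ n₀)
    (hpf01 : ∀ i y, pf i y = 0 ∨ pf i y = 1) (hph : ∀ i y, pf i y * hf i y = hf i y)
    (hh1 : ∀ i y, |hf i y| ≤ 1) (hLip : ∀ i y y'', |hf i y - hf i y''| ≤ s / g.M * g.dist y y'')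
    (hcube : ∀ i y, pf i y ≠ 0 → js i ≤ g.scale y ∧ g.scale y ≤ js i + 1)
    (hgap : ∀ i y y'', pf i y = 0 → hf i y'' ≠ 0 → mg * g.M ≤ g.dist y y'')
    (hX : ∀ y y'', |g.len y'' ^ d * X y y''| ≤ BX * g.len y ^ p * Real.exp (-(1 / 2 * δ₀ * g.dist y y'')))
    (hXw : ∀ i y y'', |g.len y'' ^ d * Xw i y y''| ≤ BX * g.len y ^ p * Real.exp (-(1 / 2 * δ₀ * g.dist y y'')))
    (hdom : ∀ i y y'', |pf i y * (g.len y'' ^ d * (Xw i y y'' - X y y'')) * hf i y''| ≤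
      BD * Real.exp (-(c₃ * g.M)) * g.len y ^ p * Real.exp (-(1 / 2 * δ₀ * g.dist y y'')))
    (h2148 : ∀ i y y', pf i y ≠ 0 → pf i y' ≠ 0 →
      |Ck i y y'| ≤ BC / (g.L ^ js i * g.eta) ^ (d + p) * Real.exp (-(δ₁ * g.dist y y')))
    (hCk0 : ∀ i y'' y', pf i y'' = 0 → Ck i y'' y' = 0) (y y' : g.Site) :
    |mat (R282 (kerOp (fun z => g.len z ^ d) X) (fun i => mulOp (pf i))
        (fun i => kerOp (fun z => g.len z ^ d) (Xw i)) (fun i => mulOp (hf i))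
        (fun i => kerOp (fun z => g.len z ^ d) (Ck i))) y y'| ≤
      theta285TLP g d p n₀ s δ₀ cσ c₃ mg BX BD BC * Real.exp (-(δ₁ * g.dist y y')) := by
  have hc0 : 0 ≤ cσ := c_nonneg_of_ineq261With h261σ y
  have hL0 : 0 < g.L := zero_lt_one.trans_le hL
  have hεd : 0 ≤ kappa2P g d p s δ₀ cσ BX BC / g.M + kappa3P g d p cσ BD BC * Real.exp (-(c₃ * g.M)) := by
    unfold kappa2P kappa3P; positivity
  have hεo : 0 ≤ kappa4TLP g d p cσ BX BC * Real.exp (-((1 / 8 * δ₀ * mg) * g.M)) := by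
    unfold kappa4TLP kappa4P; positivity
  have h := mat_R282_abs_le (kerOp (fun z => g.len z ^ d) X) (fun i => kerOp (fun z => g.len z ^ d) (Xw i))
    (fun i => kerOp (fun z => g.len z ^ d) (Ck i)) pf hf hover (E := fun y y' => Real.exp (-(δ₁ * g.dist y y')))
    (fun _ _ => (Real.exp_pos _).le) hεd hεo
    (fun i y y' => mat_diag_abs_le_pow d p htri hd hL hη hδ₀ hδ₁ hsplit h261σ hs hM hBX hBD hBC hpf01 hph hh1 hLip
      hcube hXw hdom h2148 hCk0 i y y')
    (fun i i' hii y y' => mat_off_abs_le_pow_twoLevel d p htri hd hsep hL hη hδ₀ hδ₁ hsplit h261σ hRM hthr hBX hBC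
      hpf01 hph hh1 hcube hgap hX h2148 hii y y') y y'
  refine h.trans (le_of_eq ?_)
  simp only [theta285TLP]

/-- **THE ASSEMBLED INVERSE AT POWER p, TWO-LEVEL SUPPORTS** — the statement of `B6Prop27Kernel.inverse_assembled_pow`
(same carrier 𝔅 = `g.Site` with the pairing (2.69), same located inputs, same conclusion: existence and uniqueness of the
two-sided inverse G of X = K_w(X) — QGQ* for p = 2, Q′G′²Q′* for p = 4 —, G = C + GR ((2.86)), and |G(y, y′)| ≤
2n₀B_C L^{d+p}c·(L^jη)^{−p}(L^{j′}η)^{−d}e^{−½δ₁d(y,y′)} ((2.149) ∕ (2.87))) WITHOUT the hypothesis `hlev` "supp h_□ on one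
level": the supports may meet the two adjacent levels j_□, j_□ + 1 of their cube, as the printed p. 235 allows (*"either
□̃ ⊂ B^j(Λ_j), or it intersects B^{j+1}(Λ_{j+1}) also"*; for Prop. 2.7 the cubes are *"the same notations as before"*,
(2.143) p. 248).  The threshold *"for M large enough"* is M ≥ 2Kᵀᴸc (`K285TLP`, ≥ the single-level K, `K285P_le_K285TLP`)
(p = 4: `B6Prop23TwoLevel.prop23_assembled_twoLevel`, same constants by `K285TLP_four`).
[cite: Balaban1984PropagatorsII, Prop. 2.3 (2.82)–(2.87) pp.237–238 + p.235; Prop. 2.7 (2.143) p.248, (2.149) p.249] -/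
theorem inverse_assembled_pow_twoLevel (d p : ℕ) (htri : Triangle254 g) (hrefl : ∀ y : g.Site, g.dist y y = 0)
    (hd : ∀ a b : g.Site, 0 ≤ g.dist a b) (hsep : LevelSep g) (hL : 1 ≤ g.L) (hη : 0 < g.eta)
    (hM : 0 < g.M) (hRM : 0 ≤ g.R * g.M)
    {δ₀ δ₁ σ cσ c c₃ s mg BX BD BC : ℝ} (hδ₀ : 0 < δ₀) (hδ₁ : 0 ≤ δ₁) (hsplit : δ₁ + σ * δ₀ ≤ δ₀ / 4)
    (h261σ : Ineq261With cσ g δ₀ σ) (hthr : g.L ^ p ≤ Real.exp (1 / 8 * δ₀ * g.R * g.M))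
    (h261 : Ineq261With c g δ₁ (1 / 2)) (h263 : Ineq263With c g δ₁ (1 / 2)) (hc : 0 ≤ c)
    (hc₃ : 0 < c₃) (hs : 0 ≤ s) (hmg : 0 < mg) (hBX : 0 ≤ BX) (hBD : 0 ≤ BD) (hBC : 0 ≤ BC)
    {pf hf : D → g.Site → ℝ} {js : D → ℕ} {n₀ : ℕ} {X : g.Site → g.Site → ℝ}
    {Xw Ck : D → g.Site → g.Site → ℝ}
    (hover : ∀ y, (Finset.univ.filter fun i => hf i y ≠ 0).card ≤ n₀)
    (hpf01 : ∀ i y, pf i y = 0 ∨ pf i y = 1) (hph : ∀ i y, pf i y * hf i y = hf i y)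
    (h236 : ∀ y, ∑ i, hf i y ^ 2 = 1) (hLip : ∀ i y y'', |hf i y - hf i y''| ≤ s / g.M * g.dist y y'')
    (hcube : ∀ i y, pf i y ≠ 0 → js i ≤ g.scale y ∧ g.scale y ≤ js i + 1)
    (hgap : ∀ i y y'', pf i y = 0 → hf i y'' ≠ 0 → mg * g.M ≤ g.dist y y'')
    (hX : ∀ y y'', |g.len y'' ^ d * X y y''| ≤ BX * g.len y ^ p * Real.exp (-(1 / 2 * δ₀ * g.dist y y'')))
    (hXw : ∀ i y y'', |g.len y'' ^ d * Xw i y y''| ≤ BX * g.len y ^ p * Real.exp (-(1 / 2 * δ₀ * g.dist y y'')))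
    (hdom : ∀ i y y'', |pf i y * (g.len y'' ^ d * (Xw i y y'' - X y y'')) * hf i y''| ≤
      BD * Real.exp (-(c₃ * g.M)) * g.len y ^ p * Real.exp (-(1 / 2 * δ₀ * g.dist y y'')))
    (h2148 : ∀ i y y', pf i y ≠ 0 → pf i y' ≠ 0 →
      |Ck i y y'| ≤ BC / (g.L ^ js i * g.eta) ^ (d + p) * Real.exp (-(δ₁ * g.dist y y')))
    (hCk0 : ∀ i y'' y', pf i y'' = 0 → Ck i y'' y' = 0)
    (h270 : ∀ i, locOp (fun i => mulOp (pf i)) (fun i => kerOp (fun z => g.len z ^ d) (Xw i)) i *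
      kerOp (fun z => g.len z ^ d) (Ck i) * mulOp (hf i) = mulOp (hf i))
    (hKM : 2 * K285TLP g d p n₀ s δ₀ cσ c₃ mg BX BD BC * c ≤ g.M) :
    ∃ G : Module.End ℝ (g.Site → ℝ),
      G * kerOp (fun z => g.len z ^ d) X = 1 ∧ kerOp (fun z => g.len z ^ d) X * G = 1 ∧
      G = Cglued (fun i => mulOp (hf i)) (fun i => kerOp (fun z => g.len z ^ d) (Ck i)) +
        G * R282 (kerOp (fun z => g.len z ^ d) X) (fun i => mulOp (pf i))
          (fun i => kerOp (fun z => g.len z ^ d) (Xw i)) (fun i => mulOp (hf i))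
          (fun i => kerOp (fun z => g.len z ^ d) (Ck i)) ∧
      (∀ G' : Module.End ℝ (g.Site → ℝ), G' * kerOp (fun z => g.len z ^ d) X = 1 → G' = G) ∧
      ∀ y y', |mat G y y' / g.len y' ^ d| ≤
        2 * (n₀ * (BC * g.L ^ (d + p))) * c * g.len y ^ (-(p : ℝ)) * g.len y' ^ (-(d : ℝ)) *
          Real.exp (-(δ₁ / 2 * g.dist y y')) := by
  -- an empty carrier 𝔅 makes every operator on ℝ^𝔅 equal: nothing to prove
  rcases isEmpty_or_nonempty g.Site with he | hne
  · exact ⟨0, Subsingleton.elim _ _, Subsingleton.elim _ _, Subsingleton.elim _ _, fun G' _ => Subsingleton.elim _ _,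
      fun y _ => (he.false y).elim⟩
  obtain ⟨y₀⟩ := hne
  have hcσ : 0 ≤ cσ := c_nonneg_of_ineq261With h261σ y₀
  have hL0 : 0 < g.L := zero_lt_one.trans_le hL
  have hlen : ∀ z : g.Site, 0 < g.len z := fun z => mul_pos (pow_pos hL0 _) hη
  have hh1 : ∀ i y, |hf i y| ≤ 1 := abs_hf_le_one h236
  -- the (2.82)-type equality X·C = 1 − R
  have hphOp : ∀ i, mulOp (pf i) * mulOp (hf i) = mulOp (hf i) := by
    intro i
    rw [mulOp_mul_mulOp]
    exact congrArg mulOp (funext fun y => hph i y)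
  have hXC := expansion282 (kerOp (fun z => g.len z ^ d) X) (p := fun i => mulOp (pf i))
    (t := fun i => kerOp (fun z => g.len z ^ d) (Xw i)) (h := fun i => mulOp (hf i))
    (c := fun i => kerOp (fun z => g.len z ^ d) (Ck i)) hphOp (partitionSq_mulOp hf h236) h270
  -- (2.85) with θᵀᴸ explicit, θᵀᴸ ≤ Kᵀᴸ/M, «M large enough»
  set θ : ℝ := theta285TLP g d p n₀ s δ₀ cσ c₃ mg BX BD BC with hθdef
  have hθ0 : 0 ≤ θ := by
    rw [hθdef]; unfold theta285TLP kappa2P kappa3P kappa4TLP kappa4P; positivity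
  have hR : ∀ y y', |mat (R282 (kerOp (fun z => g.len z ^ d) X) (fun i => mulOp (pf i))
      (fun i => kerOp (fun z => g.len z ^ d) (Xw i)) (fun i => mulOp (hf i))
      (fun i => kerOp (fun z => g.len z ^ d) (Ck i))) y y'| ≤ θ * Real.exp (-(δ₁ * g.dist y y')) :=
    fun y y' => mat_R_abs_le_pow_twoLevel d p htri hd hsep hL hη hM hRM hδ₀ hδ₁ hsplit h261σ hthr hs hBX hBD hBC
      hover hpf01 hph hh1 hLip hcube hgap hX hXw hdom h2148 hCk0 y y'
  have hθK : θ ≤ K285TLP g d p n₀ s δ₀ cσ c₃ mg BX BD BC / g.M :=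
    theta285TLP_le hM hδ₀ hc₃ hmg hcσ hBX hBD hBC hL0.le
  obtain ⟨-, hsmall, hinv2⟩ := smallness_of_M_large hM hc hθK hKM
  -- the C-majorant from the glued cube inverses
  have hscH : ∀ i y, hf i y ≠ 0 → g.scale y ≤ js i + 1 :=
    fun i y h => (hcube i y (pf_ne_zero_of_hf_ne_zero hph h)).2
  have h2148H : ∀ i y y', hf i y ≠ 0 → hf i y' ≠ 0 →
      |Ck i y y'| ≤ BC / (g.L ^ js i * g.eta) ^ (d + p) * Real.exp (-(δ₁ * g.dist y y')) :=
    fun i y y' hy hy' => h2148 i y y' (pf_ne_zero_of_hf_ne_zero hph hy) (pf_ne_zero_of_hf_ne_zero hph hy')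
  have hC := mat_Cglued_abs_le_pow d p hL hη hf Ck js hover hh1 hscH hBC h2148H
  set A : ℝ := n₀ * (BC * g.L ^ (d + p)) with hAdef
  have hA : 0 ≤ A := by positivity
  obtain ⟨G, hGX, hXG, hfix, huniq, hb⟩ := inverse_kernel_pow d p hL0 hη c δ₁ θ A hA hθ0 hc hδ₁ htri hrefl hd
    h261 h263 hsmall hXC (fun y y' => hC y y') hR
  refine ⟨G, hGX, hXG, hfix, huniq, fun y y' => (hb y y').trans ?_⟩
  have hP : 0 ≤ g.len y ^ (-(p : ℝ)) * g.len y' ^ (-(d : ℝ)) * Real.exp (-(δ₁ / 2 * g.dist y y')) := by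
    have := (hlen y).le; have := (hlen y').le; positivity
  calc A * c * (1 - θ * c)⁻¹ * g.len y ^ (-(p : ℝ)) * g.len y' ^ (-(d : ℝ)) * Real.exp (-(δ₁ / 2 * g.dist y y'))
      = (1 - θ * c)⁻¹ * (A * c) *
          (g.len y ^ (-(p : ℝ)) * g.len y' ^ (-(d : ℝ)) * Real.exp (-(δ₁ / 2 * g.dist y y'))) := by ring
    _ ≤ 2 * (A * c) * (g.len y ^ (-(p : ℝ)) * g.len y' ^ (-(d : ℝ)) * Real.exp (-(δ₁ / 2 * g.dist y y'))) :=
        mul_le_mul_of_nonneg_right (mul_le_mul_of_nonneg_right hinv2 (mul_nonneg hA hc)) hP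
    _ = 2 * A * c * g.len y ^ (-(p : ℝ)) * g.len y' ^ (-(d : ℝ)) * Real.exp (-(δ₁ / 2 * g.dist y y')) := by
        ring

end Pieces

/-! ## §4. The edge p = 2 without `hlev`: the assembled inverse of QGQ* ⟹ `B6.Prop27Printed` (Proposition 2.7, (2.149)) -/

section Edge

/-- **THE EDGE `inverse_assembled_pow_twoLevel` (p = 2) ⟹ `B6.Prop27Printed` — PROPOSITION 2.7 BY ITS PRINTED PROOF FOR
THE PRINTED TWO-LEVEL COVER.**  The statement of `B6Prop27Kernel.prop27Printed_of_assembled` (a family of situations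
`geo : I → B6.Geometry` with cube data, kernels X_i = QGQ* with the (2.142) majorant, X̃_{i,□} = QG_□Q*, C_{i,□} with the
(2.148) bound in the d-metric form, UNIFORM constants, a common threshold M₁ ≥ 2Kᵀᴸ_i c (`K285TLP … 2`), L_i² ≤ e^{⅛δ₀R_iM_i}
above the threshold, a common O(1) C ≥ 2n₀B_C L_i^{d+2}c, the dictionary "`Qinv i` is the (2.69)-kernel of an inverse of
X_i whenever M₁ ≤ M_i") WITHOUT the single-level hypothesis `hlev`; conclusion the printed Proposition 2.7 in the verbatim
typing of `…B6`, witnesses (M₁, δ₄, C). [cite: Balaban1984PropagatorsII, Prop. 2.7, (2.142)–(2.143) p.248, (2.148)–(2.149) p.249 + p.235] -/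
theorem prop27Printed_of_assembled_twoLevel {I : Type} (d : ℕ) (geo : I → B6.Geometry)
    [∀ i, DecidableEq (geo i).Site] (Qinv : ∀ i, B6.SiteKernel (geo i))
    (htri : ∀ i, Triangle254 (geo i)) (hrefl : ∀ i (y : (geo i).Site), (geo i).dist y y = 0)
    (hd : ∀ i (a b : (geo i).Site), 0 ≤ (geo i).dist a b) (hsep : ∀ i, LevelSep (geo i))
    (hL : ∀ i, 1 ≤ (geo i).L) (hη : ∀ i, 0 < (geo i).eta) (hM : ∀ i, 0 < (geo i).M)
    (hRM : ∀ i, 0 ≤ (geo i).R * (geo i).M)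
    {δ₀ δ₄ σ cσ c c₃ s mg BX BD BC M₁ C : ℝ} {n₀ : ℕ}
    (hδ₀ : 0 < δ₀) (hδ₄ : 0 < δ₄) (hsplit : δ₄ + σ * δ₀ ≤ δ₀ / 4)
    (h261σ : ∀ i, Ineq261With cσ (geo i) δ₀ σ)
    (hthr : ∀ i, M₁ ≤ (geo i).M → (geo i).L ^ 2 ≤ Real.exp (1 / 8 * δ₀ * (geo i).R * (geo i).M))
    (h261 : ∀ i, Ineq261With c (geo i) δ₄ (1 / 2)) (h263 : ∀ i, Ineq263With c (geo i) δ₄ (1 / 2)) (hc : 0 ≤ c)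
    (hc₃ : 0 < c₃) (hs : 0 ≤ s) (hmg : 0 < mg) (hBX : 0 ≤ BX) (hBD : 0 ≤ BD) (hBC : 0 ≤ BC)
    (hM₁ : 0 < M₁) (hC : 0 < C)
    (hKM : ∀ i, 2 * K285TLP (geo i) d 2 n₀ s δ₀ cσ c₃ mg BX BD BC * c ≤ M₁)
    (hCB : ∀ i, 2 * (n₀ * (BC * (geo i).L ^ (d + 2))) * c ≤ C)
    {D : I → Type} [∀ i, Fintype (D i)] [∀ i, DecidableEq (D i)]
    {pf hf : ∀ i, D i → (geo i).Site → ℝ} {js : ∀ i, D i → ℕ} {X : ∀ i, (geo i).Site → (geo i).Site → ℝ}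
    {Xw Ck : ∀ i, D i → (geo i).Site → (geo i).Site → ℝ}
    (hover : ∀ i y, (Finset.univ.filter fun a => hf i a y ≠ 0).card ≤ n₀)
    (hpf01 : ∀ i a y, pf i a y = 0 ∨ pf i a y = 1) (hph : ∀ i a y, pf i a y * hf i a y = hf i a y)
    (h236 : ∀ i y, ∑ a, hf i a y ^ 2 = 1)
    (hLip : ∀ i a y y'', |hf i a y - hf i a y''| ≤ s / (geo i).M * (geo i).dist y y'')
    (hcube : ∀ i a y, pf i a y ≠ 0 → js i a ≤ (geo i).scale y ∧ (geo i).scale y ≤ js i a + 1)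
    (hgap : ∀ i a y y'', pf i a y = 0 → hf i a y'' ≠ 0 → mg * (geo i).M ≤ (geo i).dist y y'')
    (hX : ∀ i y y'', |(geo i).len y'' ^ d * X i y y''| ≤
      BX * (geo i).len y ^ 2 * Real.exp (-(1 / 2 * δ₀ * (geo i).dist y y'')))
    (hXw : ∀ i a y y'', |(geo i).len y'' ^ d * Xw i a y y''| ≤
      BX * (geo i).len y ^ 2 * Real.exp (-(1 / 2 * δ₀ * (geo i).dist y y'')))
    (hdom : ∀ i a y y'', |pf i a y * ((geo i).len y'' ^ d * (Xw i a y y'' - X i y y'')) * hf i a y''| ≤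
      BD * Real.exp (-(c₃ * (geo i).M)) * (geo i).len y ^ 2 * Real.exp (-(1 / 2 * δ₀ * (geo i).dist y y'')))
    (h2148 : ∀ i a y y', pf i a y ≠ 0 → pf i a y' ≠ 0 →
      |Ck i a y y'| ≤ BC / ((geo i).L ^ js i a * (geo i).eta) ^ (d + 2) * Real.exp (-(δ₄ * (geo i).dist y y')))
    (hCk0 : ∀ i a y'' y', pf i a y'' = 0 → Ck i a y'' y' = 0)
    (h270 : ∀ i a, locOp (fun a => mulOp (pf i a)) (fun a => kerOp (fun z => (geo i).len z ^ d) (Xw i a)) a *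
      kerOp (fun z => (geo i).len z ^ d) (Ck i a) * mulOp (hf i a) = mulOp (hf i a))
    (hinv : ∀ i, M₁ ≤ (geo i).M → ∃ G : Module.End ℝ ((geo i).Site → ℝ),
      G * kerOp (fun z => (geo i).len z ^ d) (X i) = 1 ∧
        ∀ y y', (Qinv i).ker y y' = mat G y y' / (geo i).len y' ^ d) :
    B6.Prop27Printed d geo Qinv := by
  refine ⟨M₁, δ₄, C, hM₁, hδ₄, hC, fun i _ hMi y y' => ?_⟩
  obtain ⟨G, -, -, -, huniq, hb⟩ := inverse_assembled_pow_twoLevel (g := geo i) d 2 (htri i) (hrefl i) (hd i)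
    (hsep i) (hL i) (hη i) (hM i) (hRM i) hδ₀ hδ₄.le hsplit (h261σ i) (hthr i hMi) (h261 i) (h263 i) hc hc₃ hs
    hmg hBX hBD hBC (hover i) (hpf01 i) (hph i) (h236 i) (hLip i) (hcube i) (hgap i) (hX i) (hXw i) (hdom i)
    (h2148 i) (hCk0 i) (h270 i) ((hKM i).trans hMi)
  obtain ⟨G', hG'X, hker⟩ := hinv i hMi
  rw [hker y y', huniq G' hG'X]
  refine (hb y y').trans ?_
  have hL0 : 0 < (geo i).L := zero_lt_one.trans_le (hL i)
  have hlen : ∀ z : (geo i).Site, 0 < (geo i).len z := fun z => mul_pos (pow_pos hL0 _) (hη i)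
  have h2 : ((2 : ℕ) : ℝ) = (2 : ℝ) := by norm_num
  rw [h2]
  exact mul_le_mul_of_nonneg_right (mul_le_mul_of_nonneg_right (mul_le_mul_of_nonneg_right (hCB i)
    (Real.rpow_nonneg (hlen y).le _)) (Real.rpow_nonneg (hlen y').le _)) (Real.exp_pos _).le

end Edge

/-! ## §5. The dictionary p = 4: the constants ARE those of `…B6Prop23TwoLevel` -/

section Dictionary

variable (g : B6.Geometry)

/-- DICTIONARY p = 4: κ₄ᵀᴸ at power 4 is gen-14's `B6Prop23TwoLevel.kappa4TL` (B_X(B_C L^{d+4})c_σL⁸). [folklore] -/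
theorem kappa4TLP_four (d : ℕ) (cσ BX BC : ℝ) : kappa4TLP g d 4 cσ BX BC = kappa4TL g d cσ BX BC := by
  unfold kappa4TLP kappa4P kappa4TL
  ring

/-- DICTIONARY p = 4: θᵀᴸ at power 4 is `B6Prop23TwoLevel.theta285TL`. [folklore] -/
theorem theta285TLP_four (d n₀ : ℕ) (s δ₀ cσ c₃ mg BX BD BC : ℝ) :
    theta285TLP g d 4 n₀ s δ₀ cσ c₃ mg BX BD BC = theta285TL g d n₀ s δ₀ cσ c₃ mg BX BD BC := by
  unfold theta285TLP theta285TL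
  rw [kappa2P_four, kappa3P_four, kappa4TLP_four]

/-- DICTIONARY p = 4: Kᵀᴸ at power 4 is `B6Prop23TwoLevel.K285TL`, so the threshold of `inverse_assembled_pow_twoLevel` at
p = 4 is LITERALLY that of `B6Prop23TwoLevel.prop23_assembled_twoLevel` (which is therefore not re-filed here). [folklore] -/
theorem K285TLP_four (d n₀ : ℕ) (s δ₀ cσ c₃ mg BX BD BC : ℝ) :
    K285TLP g d 4 n₀ s δ₀ cσ c₃ mg BX BD BC = K285TL g d n₀ s δ₀ cσ c₃ mg BX BD BC := by
  unfold K285TLP K285TL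
  rw [kappa2P_four, kappa3P_four, kappa4TLP_four]

end Dictionary

/-! ## §6. Consistency of the p = 2 two-level edge on gen-14's two-level model (where `hlev` fails) -/

section TwoLevelModel

/-- The constant Kᵀᴸ at power p on the two-level model `B6Prop23TwoLevel.tlGeo` is 2/e (n₀ = 1, s = 0, δ₀ = 8, c_σ = 2,
c₃ = m_g = B_X = B_C = 1, B_D = 0; L = 1, so every power of L is 1). [folklore] -/
theorem tlGeo_K285TLP (d p : ℕ) : K285TLP tlGeo d p 1 0 8 2 1 1 1 0 1 = 2 / Real.exp 1 := by
  unfold K285TLP kappa2P kappa3P kappa4TLP kappa4P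
  norm_num

/-- «M large enough» at power p on the two-level model: 2Kᵀᴸ·c = 8/e ≤ 4 = M (c = 2). [folklore] -/
theorem tlGeo_thresholdP_tl (d p : ℕ) : 2 * K285TLP tlGeo d p 1 0 8 2 1 1 1 0 1 * 2 ≤ 4 := by
  have h2e : (2 : ℝ) ≤ Real.exp 1 := by
    have := Real.add_one_le_exp (1 : ℝ); norm_num at this ⊢; linarith
  have he : 0 < Real.exp 1 := Real.exp_pos 1
  rw [tlGeo_K285TLP]
  rw [show 2 * (2 / Real.exp 1) * 2 = 8 / Real.exp 1 by ring, div_le_iff₀ he]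
  linarith

/-- **NON-VACUITY OF THE p = 2 TWO-LEVEL EDGE ON A TWO-LEVEL MODEL**: on the one-situation family over gen-14's
`B6Prop23TwoLevel.tlGeo` (one cube, □ = h_□ = 1, Kronecker kernels X = X̃_□ = C_□, cube scale j_□ = 0 with sites at the
scales 0 AND 1 — so `hlev` FAILS there, `B6Prop23TwoLevel.tlGeo_hlev_fails` —, δ₀ = 8, δ₄ = 1, σ = s = B_D = 0, c_σ = c = 2,
c₃ = m_g = B_X = B_C = 1, n₀ = 1, M₁ = 4, C = 4, Qinv = the Kronecker kernel = the (2.69)-kernel of the inverse 1 of X = 1)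
every hypothesis of `prop27Printed_of_assembled_twoLevel` is discharged — the term below is the theorem applied there — so
`B6.Prop27Printed` holds on that family by this route and the two-level hypothesis package at p = 2 is consistent on data
violating `hlev`. [folklore] -/
theorem prop27Printed_twoLevel_tl (d : ℕ) :
    B6.Prop27Printed d (fun _ : Unit => tlGeo) (fun _ => ⟨fun y y' => if y = y' then (1 : ℝ) else 0⟩) :=
  prop27Printed_of_assembled_twoLevel (geo := fun _ : Unit => tlGeo) d _ (δ₀ := 8) (δ₄ := 1) (σ := 0) (cσ := 2)
    (c := 2) (c₃ := 1) (s := 0) (mg := 1) (BX := 1) (BD := 0) (BC := 1) (M₁ := 4) (C := 4) (n₀ := 1)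
    (D := fun _ => Unit) (pf := fun _ _ _ => 1) (hf := fun _ _ _ => 1) (js := fun _ _ => 0)
    (X := fun _ y y'' => if y = y'' then 1 else 0) (Xw := fun _ _ y y'' => if y = y'' then 1 else 0)
    (Ck := fun _ _ y y'' => if y = y'' then 1 else 0)
    (fun _ _ _ _ => by simp) (fun _ _ => rfl) (fun _ _ _ => le_rfl)
    (fun _ y y' => by show (0 : ℝ) * 4 * mx tlGeo y y' ≤ 0; simp) (fun _ => le_rfl) (fun _ => one_pos)
    (fun _ => by show (0 : ℝ) < 4; norm_num) (fun _ => by show (0 : ℝ) ≤ 0 * 4; norm_num) (by norm_num) one_pos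
    (by norm_num) (fun _ => tlGeo_ineq261 8 0) (fun _ _ => by simp) (fun _ => tlGeo_ineq261 1 (1 / 2))
    (fun _ => tlGeo_ineq263 1 (1 / 2)) zero_le_two one_pos le_rfl one_pos zero_le_one le_rfl zero_le_one
    (by norm_num) (by norm_num) (fun _ => tlGeo_thresholdP_tl d 2) (fun _ => by norm_num)
    (fun _ _ => (Finset.card_filter_le _ _).trans (by simp)) (fun _ _ _ => Or.inr rfl) (fun _ _ _ => one_mul _)
    (fun _ _ => by simp) (fun _ _ _ _ => by simp) (fun _ _ y _ => ⟨Nat.zero_le _, tlGeo_scale_le_one y⟩)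
    (fun _ _ _ _ h _ => absurd h one_ne_zero)
    (fun _ y y'' => by by_cases h : y = y'' <;> simp [h])
    (fun _ _ y y'' => by by_cases h : y = y'' <;> simp [h])
    (fun _ _ _ _ => by simp) (fun _ _ y y' _ _ => by by_cases h : y = y' <;> simp [h])
    (fun _ _ _ _ h => absurd h one_ne_zero)
    (fun _ _ => by
      simp only [tlGeo_len, one_pow, locOp, kerOp_one_delta, mulOp_const_one, mul_one])
    (fun _ _ => ⟨1, by simp only [tlGeo_len, one_pow, kerOp_one_delta, mul_one], fun y y' => by
      rw [mat_one]; simp⟩)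

end TwoLevelModel

end Literature.MathematicalPhysics.QuantumFieldTheory.Balaban1983to89.B6Prop27TwoLevel
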